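import Summits.AtomisticToContinuum.Crystallization.Theorems.OverbindingBudgetAffineCompressedCutInnerT
import Summits.AtomisticToContinuum.Crystallization.Theorems.OverbindingBudgetAffineCompressedCutSharpC

/-!
# `OverbindingBudget` / crux `RobustDefectLimitWindows` (stmt-AtomisticToContinuum-31280) — «InnerS»: SOUNDNESS of the class tables

Support file (lens-4, residual programme (iii) «CompressedCut», leaf `NearFieldSlackMinSecond 12 (1/25)`; plan «Inner» I0/I2).
What the kernel-decided checks of «InnerT» say about an inner site `m ≠ i` of the affinely deep ball (`dist ≤ 106/25·ν`) that is NOT a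
registered first-shell neighbour of `i`, read by the layer-rigidity record at the label `ref ℓ + x` (clause 4) with the record's COARSE
resolution:

* `col_form` — the column site of layer `ℓ` is `(2ℓ + σ, 2ℓ + σ, 2ℓ − 2σ)` with `|σ| ≤ |ℓ|`, `σ ≡ ℓ (mod 2)` (`…SharpB.ref_form`, both signs);
* `label_range` — the label `r = ref ℓ + x` has `tsq r ≤ 387` (coarse reading + `dist ≤ 106/25·ν`), `tsq r ≠ 0` (else `m = i`, clause 5) and
  `tsq r ≠ 18` (else `m` is within `1.3928ν`, hence registered at `i` by a pattern vector of norm `1` — excluded — or `√2` — too far);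
* `coord_box` — `tsq r ≤ 387` puts the label in the clause-1 box `|u_c| ≤ 18 − |ℓ|`;
* `layer_sound`, `classOk_sound`, `entryOk_sound` — unpacking of the Boolean checks; `dist_lower`, `inv_pow_six_le` — their real content;
* ★ `site_bound` — with `x − x₀ = (3a, 3b, −3a − 3b)`: the entry `eOf ℓ σ a b` lies in the class table, carries the key `(sgOf σ·a, sgOf σ·b)`, and
  `(dist (y i) (y m))⁻⁶ ≤ ν⁻⁶ · t/10⁶` for its `t`-field — via the SHARP reading `…SharpC.sharp_site` at depth `p = |ℓ| + (|a| + |b| + |a + b|)/2`.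
[this file: statements + proofs; no new definitions]
-/

namespace Summit.AtomisticToContinuum.Crystallization.Theorems.OverbindingBudgetAffineCompressedCutInnerS

open Literature.Geometry.DiscreteGeometry (nearestDist nearestDist_nonneg fccTwoShellPattern hcpTwoShellPattern norm_of_mem_fccTwoShellPattern
  norm_of_mem_hcpTwoShellPattern)
open Summit.AtomisticToContinuum.Crystallization.Theorems.OverbindingBudgetAffineCompressedCutKernel (T3 tsub tadd tsq thsum fccL fccNegL hcpL hcpAltL
  impB impB_eq_true)
open Summit.AtomisticToContinuum.Crystallization.Theorems.OverbindingBudgetAffineCompressedCutCharts (mv mv_zero mv_injective norm_mv_sq norm_mv_eq_one_iff)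
open Summit.AtomisticToContinuum.Crystallization.Theorems.OverbindingBudgetAffineCompressedCutEstablish (Estab)
open Summit.AtomisticToContinuum.Crystallization.Theorems.OverbindingBudgetAffineCompressedCutEstablishTwo (IsSign flipIso)
open Summit.AtomisticToContinuum.Crystallization.Theorems.OverbindingBudgetAffineCompressedCutSeed (InLayer lnorm inLayer_tsub)
open Summit.AtomisticToContinuum.Crystallization.Theorems.OverbindingBudgetAffineCompressedCutPatch (capv dL)
open Summit.AtomisticToContinuum.Crystallization.Theorems.OverbindingBudgetAffineCompressedCutBoxBounds (tsq_tadd_axis)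
open Summit.AtomisticToContinuum.Crystallization.Theorems.OverbindingBudgetAffineCompressedCutBudget (tauR dR coord_sq_le)
open Summit.AtomisticToContinuum.Crystallization.Theorems.OverbindingBudgetAffineCompressedCutRun (tsub_tadd_self)
open Summit.AtomisticToContinuum.Crystallization.Theorems.OverbindingBudgetAffineCompressedCutSharpB (ref_form)
open Summit.AtomisticToContinuum.Crystallization.Theorems.OverbindingBudgetAffineCompressedCutSharpC (sharp_site)
open Summit.AtomisticToContinuum.Crystallization.Theorems.OverbindingBudgetAffineCompressedCutInnerT (tblOf Mq Dnum tOfE findE entryOk boxL sgOf Tof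
  eOf classOk sigmaL layerOk layerOk_of_mem)

/-! ## §1  Unpacking the Boolean checks -/

/-- `|a| ≤ 8 → a ∈ boxL`. [this file] -/
theorem mem_boxL {a : ℤ} (ha : |a| ≤ 8) : a ∈ boxL := by
  obtain ⟨h1, h2⟩ := abs_le.mp ha
  unfold boxL
  refine List.mem_map.2 ⟨(a + 8).toNat, List.mem_range.2 ?_, ?_⟩
  · omega
  · show ((a + 8).toNat : ℤ) - 8 = a
    omega

/-- The layer check at an admissible column offset: class check, total `Σ t ≤ M_{|ℓ|}`, no duplicate rows. [this file] -/
theorem layer_sound {ℓ σ : ℤ} (hℓ1 : -5 ≤ ℓ) (hℓ2 : ℓ ≤ 5) (hσ1 : |σ| ≤ |ℓ|) (hσ2 : (2 : ℤ) ∣ (σ + |ℓ|)) :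
    classOk ℓ σ = true ∧ ((tblOf ℓ.natAbs σ.natAbs).map tOfE).sum ≤ Mq ℓ.natAbs ∧ (tblOf ℓ.natAbs σ.natAbs).Nodup := by
  have h := layerOk_of_mem hℓ1 hℓ2
  have hσ8 : |σ| ≤ 8 := hσ1.trans ((abs_le.mpr ⟨by omega, hℓ2⟩).trans (by norm_num))
  have hmem : σ ∈ sigmaL ℓ := by
    simp only [sigmaL, List.mem_filter, Bool.and_eq_true, decide_eq_true_eq, beq_iff_eq]
    refine ⟨mem_boxL hσ8, ?_, ?_⟩
    · have h' : ((σ.natAbs : ℕ) : ℤ) ≤ ((ℓ.natAbs : ℕ) : ℤ) := by rw [Int.natCast_natAbs, Int.natCast_natAbs]; exact hσ1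
      exact_mod_cast h'
    · rcases abs_choice ℓ with e | e <;> rw [e] at hσ2 <;> omega
  have h1 := (List.all_eq_true.1 h) σ hmem
  simp only [Bool.and_eq_true, decide_eq_true_eq] at h1
  exact ⟨h1.1.1, h1.1.2, h1.2⟩

/-- The class check delivers the entry of every key in range. [this file] -/
theorem classOk_sound {ℓ σ a b : ℤ} (h : classOk ℓ σ = true) (ha : |a| ≤ 8) (hb : |b| ≤ 8) (hT : Tof ℓ σ a b ≤ 387)
    (h0 : Tof ℓ σ a b ≠ 0) (h18 : Tof ℓ σ a b ≠ 18) :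
    eOf ℓ σ a b ∈ tblOf ℓ.natAbs σ.natAbs ∧ entryOk ℓ.natAbs (Tof ℓ σ a b) (sgOf σ * a) (sgOf σ * b) (eOf ℓ σ a b) = true := by
  simp only [classOk, List.all_eq_true, impB_eq_true] at h
  have h3 := h a (mem_boxL ha) b (mem_boxL hb)
    (by simp only [Bool.and_eq_true, decide_eq_true_eq, bne_iff_ne]; exact ⟨⟨hT, h0⟩, h18⟩)
  unfold eOf
  split at h3
  · exact absurd h3 Bool.false_ne_true
  · next e he =>
    rw [he]
    exact ⟨by simpa [findE] using List.mem_of_find?_eq_some he, h3⟩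

/-- The fields of a checked entry. [this file] -/
theorem entryOk_sound {q : ℕ} {T a b : ℤ} {e : ℤ × ℤ × ℕ × ℕ × ℕ} (h : entryOk q T a b e = true) :
    e.1 = a ∧ e.2.1 = b ∧ q ≤ e.2.2.1 ∧ 2 * (e.2.2.1 - q) = a.natAbs + b.natAbs + (a + b).natAbs ∧ e.2.2.1 + 1 ≤ 31 ∧ 0 < e.2.2.2.1 ∧
      (((18 * (400 * (e.2.2.2.1 + Dnum e.2.2.1)) ^ 2 : ℕ) : ℤ) ≤ T * 159201000000000000) ∧
      (4240000 < e.2.2.2.1 ∨ 10 ^ 42 ≤ tOfE e * e.2.2.2.1 ^ 6) := by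
  simp only [entryOk, Bool.and_eq_true, Bool.or_eq_true, decide_eq_true_eq, beq_iff_eq] at h
  obtain ⟨⟨⟨⟨⟨⟨⟨h1, h2⟩, h3⟩, h4⟩, h5⟩, h6⟩, h7⟩, h8⟩ := h
  exact ⟨h1, h2, h3, h4, h5, h6, h7, h8⟩

/-- `|sgOf σ · a| = |a|` (as natural numbers). [this file] -/
theorem natAbs_sg_mul (σ a : ℤ) : (sgOf σ * a).natAbs = a.natAbs := by
  unfold sgOf
  split <;> simp [Int.natAbs_neg]

/-- `sgOf σ · a + sgOf σ · b = sgOf σ · (a + b)`. [this file] -/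
theorem sg_mul_add (σ a b : ℤ) : sgOf σ * a + sgOf σ * b = sgOf σ * (a + b) := by ring

/-- `sgOf σ ≠ 0`. [this file] -/
theorem sgOf_ne_zero (σ : ℤ) : sgOf σ ≠ 0 := by
  unfold sgOf; split <;> norm_num

/-! ## §2  The real content of the two certificates -/

/-- `dR ν p = ν·Dnum p/10⁶`. [this file] -/
theorem dR_eq (ν : ℝ) (p : ℕ) : dR ν p = ν * (Dnum p : ℝ) / 10 ^ 6 := by
  rcases Nat.eq_zero_or_pos p with rfl | hp
  · simp [dR, Dnum]
  · have h1 : ((p - 1 : ℕ) : ℝ) = (p : ℝ) - 1 := by rw [Nat.cast_sub hp]; simp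
    simp only [dR, Dnum, Nat.cast_add, Nat.cast_mul, Nat.cast_ofNat, h1]
    ring

/-- The distance certificate: `18·(400(L + 10⁶D_p))² ≤ T·(399·10⁶)²`, `s² = T/18`, a frame lower bound `399/400·ν·s ≤ nB` and an error
`nE ≤ dR ν p` give `ν·L/10⁶ ≤ nB − nE`. [this file] -/
theorem dist_lower {ν nB nE s : ℝ} {T : ℤ} {p L : ℕ} (hν : 0 < ν) (hs : s ^ 2 = (T : ℝ) / 18) (hs0 : 0 ≤ s)
    (hBr : 399 / 400 * ν * s ≤ nB) (hE : nE ≤ dR ν p)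
    (hcert : (((18 * (400 * (L + Dnum p)) ^ 2 : ℕ) : ℤ) ≤ T * 159201000000000000)) :
    ν * (L : ℝ) / 10 ^ 6 ≤ nB - nE := by
  have h1 : ((18 * (400 * ((L : ℝ) + (Dnum p : ℝ))) ^ 2) : ℝ) ≤ (T : ℝ) * 159201000000000000 := by
    have h' : (((18 * (400 * (L + Dnum p)) ^ 2 : ℕ) : ℤ) : ℝ) ≤ ((T * 159201000000000000 : ℤ) : ℝ) := by exact_mod_cast hcert
    push_cast at h'
    exact h'
  have h2 : (400 * ((L : ℝ) + (Dnum p : ℝ))) ^ 2 ≤ (399000000 * s) ^ 2 := by nlinarith [h1, hs]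
  have h3 : 400 * ((L : ℝ) + (Dnum p : ℝ)) ≤ 399000000 * s := abs_le_of_sq_le_sq' h2 (by positivity) |>.2
  rw [dR_eq] at hE
  nlinarith [h3, hE, hν]

/-- The `t`-certificate: a site at distance `d ∈ [ν·L/10⁶, 106/25·ν]` with `L > 4240000 ∨ t·L⁶ ≥ 10⁴²` has `d⁻⁶ ≤ ν⁻⁶·t/10⁶`. [this file] -/
theorem inv_pow_six_le {ν d : ℝ} {L t : ℕ} (hν : 0 < ν) (hL : 0 < L) (hlo : ν * (L : ℝ) / 10 ^ 6 ≤ d) (hhi : d ≤ 106 / 25 * ν)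
    (ht : 4240000 < L ∨ 10 ^ 42 ≤ t * L ^ 6) : d⁻¹ ^ 6 ≤ ν⁻¹ ^ 6 * ((t : ℝ) / 10 ^ 6) := by
  have hLr : (0 : ℝ) < L := by exact_mod_cast hL
  have hx : 0 < ν * (L : ℝ) / 10 ^ 6 := by positivity
  rcases ht with h | h
  · have h' : (4240000 : ℝ) < L := by exact_mod_cast h
    nlinarith [h', hlo, hhi, hν]
  · have h42 : (10 : ℝ) ^ 42 ≤ (t : ℝ) * (L : ℝ) ^ 6 := by exact_mod_cast h
    have hd : 0 < d := hx.trans_le hlo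
    calc d⁻¹ ^ 6 ≤ (ν * (L : ℝ) / 10 ^ 6)⁻¹ ^ 6 := pow_le_pow_left₀ (inv_nonneg.2 hd.le) (inv_anti₀ hx hlo) 6
      _ = ν⁻¹ ^ 6 * ((10 ^ 6) ^ 6 / (L : ℝ) ^ 6) := by
          field_simp
      _ ≤ ν⁻¹ ^ 6 * ((t : ℝ) / 10 ^ 6) := by
          apply mul_le_mul_of_nonneg_left _ (by positivity)
          rw [div_le_div_iff₀ (by positivity) (by positivity)]
          calc ((10 : ℝ) ^ 6) ^ 6 * 10 ^ 6 = 10 ^ 42 := by norm_num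
            _ ≤ (t : ℝ) * (L : ℝ) ^ 6 := h42

/-! ## §3  The label of an inner site: column form, range, box -/

/-- COLUMN FORM of layer `ℓ ∈ [−5, 5]`: `ref ℓ + x₀ = (2ℓ + σ, 2ℓ + σ, 2ℓ − 2σ)`, `|σ| ≤ |ℓ|`, `σ ≡ ℓ (mod 2)`. [this file] -/
theorem col_form {ref : ℤ → T3} {Cz : ℤ → List T3} {e : ℤ → ℤ} {x₀ : T3}
    (hRec2 : ∀ ℓ : ℤ, -5 ≤ ℓ → ℓ ≤ 4 → (e ℓ = 1 ∨ e ℓ = -1) ∧ ref (ℓ + 1) = tadd (ref ℓ) (capv 1 (e ℓ) (1, 1, -2)) ∧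
      (∀ δ ∈ dL, capv 1 (e ℓ) δ ∈ Cz ℓ) ∧ (∀ δ ∈ dL, capv (-1) (-(e ℓ)) δ ∈ Cz (ℓ + 1)))
    (hx₀ : tadd (ref 0) x₀ = (0, 0, 0)) {ℓ : ℤ} (hℓ1 : -5 ≤ ℓ) (hℓ2 : ℓ ≤ 5) :
    ∃ σ : ℤ, |σ| ≤ |ℓ| ∧ (2 : ℤ) ∣ (σ + |ℓ|) ∧ tadd (ref ℓ) x₀ = (2 * ℓ + σ, 2 * ℓ + σ, 2 * ℓ - 2 * σ) := by
  have hq5 : ℓ.natAbs ≤ 5 := by omega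
  have hr := ref_form hRec2 hx₀ ℓ.natAbs hq5
  have hq : ((ℓ.natAbs : ℕ) : ℤ) = |ℓ| := Int.natCast_natAbs ℓ
  rcases le_or_gt 0 ℓ with hpos | hneg
  · have hℓq : ℓ = ((ℓ.natAbs : ℕ) : ℤ) := by rw [hq, abs_of_nonneg hpos]
    obtain ⟨⟨σ, hσ, hpar, hLσ⟩, -⟩ := hr
    refine ⟨σ, by rw [← hq]; exact hσ, by rw [← hq]; exact hpar, ?_⟩
    rw [hℓq, hLσ]
  · have hℓq : ℓ = -((ℓ.natAbs : ℕ) : ℤ) := by rw [hq, abs_of_neg hneg]; ring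
    obtain ⟨-, ⟨σ, hσ, hpar, hLσ⟩⟩ := hr
    refine ⟨σ, by rw [← hq]; exact hσ, by rw [← hq]; exact hpar, ?_⟩
    rw [hℓq, hLσ]
    simp only [Prod.mk.injEq]
    refine ⟨by ring, by ring, by ring⟩

/-- BOX from the range: `3c² ≤ 774 − 24ℓ²` and `|ℓ| ≤ 5` give `|c| ≤ 18 − |ℓ|` (indeed `9(|ℓ| − 2)² + 30 > 0`). [this file] -/
theorem coord_box {c ℓ : ℤ} (hc : 3 * c ^ 2 ≤ 774 - 24 * ℓ ^ 2) (hℓ : |ℓ| ≤ 5) : |c| ≤ 18 - |ℓ| := by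
  have h0 : 0 ≤ 18 - |ℓ| := by linarith [abs_nonneg ℓ]
  have hsq : c ^ 2 < (18 - |ℓ|) ^ 2 := by nlinarith [sq_abs ℓ, sq_nonneg (|ℓ| - 2), abs_nonneg ℓ]
  exact (abs_lt_of_sq_lt_sq hsq h0).le

/-- The record's coarse resolution is `0.39020747·ν`. [this file] -/
theorem coarse_eq (ν : ℝ) : dR ν 31 + 1 / 10 ^ 4 * (10347 / 10000 * ν) + tauR ν 31 = 39020747 / 100000000 * ν := by
  simp only [dR, tauR, Nat.cast_ofNat]
  ring

/-- ★ LABEL RANGE of an inner non-first-shell site `m ≠ i` read coarsely at the label `r`: `tsq r ≤ 387`, `tsq r ≠ 0`, `tsq r ≠ 18`. [this file] -/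
theorem label_range {N : ℕ} {y : Fin N → EuclideanSpace ℝ (Fin 3)} {i : Fin N} (hν : 0 < nearestDist y i)
    {A : Fin N → (EuclideanSpace ℝ (Fin 3) →ₗ[ℝ] EuclideanSpace ℝ (Fin 3))} {Qf : Fin N → (EuclideanSpace ℝ (Fin 3) →ₗᵢ[ℝ] EuclideanSpace ℝ (Fin 3))}
    {P : Fin N → Finset (EuclideanSpace ℝ (Fin 3))} {f : Fin N → EuclideanSpace ℝ (Fin 3) → EuclideanSpace ℝ (Fin 3)}
    {B : EuclideanSpace ℝ (Fin 3) →ₗ[ℝ] EuclideanSpace ℝ (Fin 3)}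
    (hP : ∀ j, dist (y j) (y i) ≤ 12 * nearestDist y i → (P j = fccTwoShellPattern ∨ P j = hcpTwoShellPattern))
    (hA : ∀ j, dist (y j) (y i) ≤ 12 * nearestDist y i → ∀ v ∈ P j, ‖A j v - Qf j v‖ ≤ 1 / 1000)
    (hf : ∀ j, dist (y j) (y i) ≤ 12 * nearestDist y i → ∀ v ∈ P j,
      f j v ∈ Set.range y ∧ dist (f j v) (y j + nearestDist y j • A j v) ≤ 1 / 10 ^ 4 * nearestDist y j)
    (hex : ∀ j, dist (y j) (y i) ≤ 12 * nearestDist y i → ∀ m, m ≠ j → dist (y m) (y j) ≤ (3 / 2 + 1 / 450) * nearestDist y j →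
      ∃ v ∈ P j, f j v = y m)
    (hBlo : ∀ z, 399 / 400 * nearestDist y i * ‖z‖ ≤ ‖B z‖) (hBup : ∀ z, ‖B z‖ ≤ 401 / 400 * nearestDist y i * ‖z‖)
    (hRec5 : ∀ (m m' : Fin N) (r : T3), 9967 / 10000 * (9026 / 10000 * nearestDist y i) ≤ nearestDist y m' →
      ‖y m - y i - B (mv r)‖ ≤ dR (nearestDist y i) 31 + 1 / 10 ^ 4 * (10347 / 10000 * nearestDist y i) + tauR (nearestDist y i) 31 →
      ‖y m' - y i - B (mv r)‖ ≤ dR (nearestDist y i) 31 + 1 / 10 ^ 4 * (10347 / 10000 * nearestDist y i) + tauR (nearestDist y i) 31 → m = m')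
    {m : Fin N} (hmi : m ≠ i) (hdm : dist (y m) (y i) ≤ 106 / 25 * nearestDist y i) (hnot : ∀ v ∈ P i, ‖v‖ = 1 → f i v ≠ y m)
    {r : T3} (hm : ‖y m - y i - B (mv r)‖ ≤ dR (nearestDist y i) 31 + 1 / 10 ^ 4 * (10347 / 10000 * nearestDist y i) + tauR (nearestDist y i) 31) :
    tsq r ≤ 387 ∧ tsq r ≠ 0 ∧ tsq r ≠ 18 := by
  have hΔ := coarse_eq (nearestDist y i)
  have htri : ‖B (mv r)‖ ≤ ‖y m - y i‖ + ‖y m - y i - B (mv r)‖ := by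
    have h := norm_sub_le (y m - y i) ((y m - y i) - B (mv r))
    rwa [sub_sub_cancel] at h
  have htri' : ‖y m - y i‖ ≤ ‖B (mv r)‖ + ‖y m - y i - B (mv r)‖ := by
    have h := norm_add_le (B (mv r)) ((y m - y i) - B (mv r))
    rwa [add_sub_cancel] at h
  have hdn : ‖y m - y i‖ = dist (y m) (y i) := (dist_eq_norm _ _).symm
  have hii : dist (y i) (y i) ≤ 12 * nearestDist y i := by rw [dist_self]; positivity
  refine ⟨?_, ?_, ?_⟩
  · -- range
    have h1 : nearestDist y i * (399 / 400 * ‖mv r‖) ≤ nearestDist y i * (463020747 / 100000000) := by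
      have := hBlo (mv r); nlinarith [this, htri, hdm, hm, hΔ, hdn]
    have h2 : ‖mv r‖ ≤ 463020747 / 100000000 * (400 / 399) := by
      have := le_of_mul_le_mul_left h1 hν; linarith
    have h3 : (tsq r : ℝ) / 18 ≤ (463020747 / 100000000 * (400 / 399)) ^ 2 := by
      rw [← norm_mv_sq]; exact pow_le_pow_left₀ (norm_nonneg _) h2 2
    have h4 : (tsq r : ℝ) < 388 := by nlinarith [h3]
    have h5 : tsq r < 388 := by exact_mod_cast h4
    omega
  · -- not the centre
    intro h0
    have hr0 : r = (0, 0, 0) := by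
      apply mv_injective
      rw [mv_zero, ← norm_eq_zero]
      have h := norm_mv_sq r
      rw [h0] at h
      simpa using h
    subst hr0
    have hi0 : ‖y i - y i - B (mv (0, 0, 0))‖ ≤
        dR (nearestDist y i) 31 + 1 / 10 ^ 4 * (10347 / 10000 * nearestDist y i) + tauR (nearestDist y i) 31 := by
      rw [mv_zero, LinearMap.map_zero, sub_self, sub_zero, norm_zero, hΔ]; positivity
    exact hmi (hRec5 m i (0, 0, 0) (by nlinarith [hν]) hm hi0)
  · -- not the first shell
    intro h18
    have hn1 : ‖mv r‖ = 1 := (norm_mv_eq_one_iff r).2 h18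
    have hd : dist (y m) (y i) ≤ (3 / 2 + 1 / 450) * nearestDist y i := by
      have := hBup (mv r); rw [hn1] at this; nlinarith [this, htri', hm, hΔ, hdn, hν]
    have hd' : dist (y m) (y i) ≤ 139270747 / 100000000 * nearestDist y i := by
      have := hBup (mv r); rw [hn1] at this; nlinarith [this, htri', hm, hΔ, hdn, hν]
    obtain ⟨v, hv, hfv⟩ := hex i hii m hmi hd
    have hnorm : ‖v‖ = 1 ∨ ‖v‖ = Real.sqrt 2 := by
      rcases hP i hii with h | h
      · exact norm_of_mem_fccTwoShellPattern (h ▸ hv)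
      · exact norm_of_mem_hcpTwoShellPattern (h ▸ hv)
    rcases hnorm with h1 | h2
    · exact hnot v hv h1 hfv
    · have hAv : Real.sqrt 2 - 1 / 1000 ≤ ‖A i v‖ := by
        have hq : ‖Qf i v‖ = Real.sqrt 2 := by rw [LinearIsometry.norm_map, h2]
        have h := hA i hii v hv
        have h' := norm_sub_norm_le (Qf i v) (A i v)
        rw [← norm_neg, neg_sub] at h
        linarith
      have hfd := (hf i hii v hv).2
      rw [hfv] at hfd
      have hsm : ‖nearestDist y i • A i v‖ = nearestDist y i * ‖A i v‖ := by
        rw [norm_smul, Real.norm_of_nonneg hν.le]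
      have hlow : nearestDist y i * ‖A i v‖ - 1 / 10 ^ 4 * nearestDist y i ≤ dist (y m) (y i) := by
        have h := dist_triangle (y i + nearestDist y i • A i v) (y m) (y i)
        rw [dist_comm (y i + nearestDist y i • A i v) (y m)] at h
        have e : dist (y i + nearestDist y i • A i v) (y i) = ‖nearestDist y i • A i v‖ := by
          rw [dist_eq_norm, add_sub_cancel_left]
        linarith [e ▸ h, hsm]
      have hs : nearestDist y i * (Real.sqrt 2 - 1 / 1000 - 1 / 10 ^ 4) ≤ nearestDist y i * (139270747 / 100000000) := by
        nlinarith [hAv, hlow, hd', hν]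
      have hs' := le_of_mul_le_mul_left hs hν
      nlinarith [Real.sq_sqrt (show (0 : ℝ) ≤ 2 by norm_num), Real.sqrt_nonneg 2, hs']

/-! ## §4  ★ The site bound -/

/-- `lnorm (3a, 3b, −3a − 3b) = 3(|a| + |b| + |a + b|)`. [this file] -/
theorem lnorm_hex {w : T3} {a b : ℤ} (ha : w.1 = 3 * a) (hb : w.2.1 = 3 * b) (hc : w.2.2 = -3 * a - 3 * b) :
    lnorm w = 3 * (|a| + |b| + |a + b|) := by
  have e3 : -3 * a - 3 * b = 3 * (-(a + b)) := by ring
  simp only [lnorm, ha, hb, hc, e3, abs_mul, abs_neg, abs_of_pos (show (0 : ℤ) < 3 by norm_num)]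
  ring

/-- ★★ **SITE BOUND.**  Ball data at `i`, base frame `B` (`(399/400)ν‖z‖ ≤ ‖Bz‖ ≤ (401/400)ν‖z‖`), a seed, the record's clauses 1, 2, 3, 5; an
inner site `m ≠ i` (`dist ≤ 106/25·ν`) that is not a registered first-shell neighbour of `i`, read coarsely at the label `ref ℓ + x` (clause 4),
with column offset `σ` of its layer and hex coordinates `(a, b)` of `x − x₀`.  Then its entry `eOf ℓ σ a b` lies in the class table of
`(|ℓ|, |σ|)` under the key `(sgOf σ·a, sgOf σ·b)`, and `dist(y i, y m)⁻⁶ ≤ ν⁻⁶ · t/10⁶` for the entry's `t`. [this file] -/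
theorem site_bound {N : ℕ} {y : Fin N → EuclideanSpace ℝ (Fin 3)} (hy : Function.Injective y) {i : Fin N} (hν : 0 < nearestDist y i)
    {A : Fin N → (EuclideanSpace ℝ (Fin 3) →ₗ[ℝ] EuclideanSpace ℝ (Fin 3))} {Qf : Fin N → (EuclideanSpace ℝ (Fin 3) →ₗᵢ[ℝ] EuclideanSpace ℝ (Fin 3))}
    {P : Fin N → Finset (EuclideanSpace ℝ (Fin 3))} {f : Fin N → EuclideanSpace ℝ (Fin 3) → EuclideanSpace ℝ (Fin 3)}
    {B : EuclideanSpace ℝ (Fin 3) →ₗ[ℝ] EuclideanSpace ℝ (Fin 3)}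
    (hP : ∀ j, dist (y j) (y i) ≤ 12 * nearestDist y i → (P j = fccTwoShellPattern ∨ P j = hcpTwoShellPattern))
    (hA : ∀ j, dist (y j) (y i) ≤ 12 * nearestDist y i → ∀ v ∈ P j, ‖A j v - Qf j v‖ ≤ 1 / 1000)
    (hf : ∀ j, dist (y j) (y i) ≤ 12 * nearestDist y i → ∀ v ∈ P j,
      f j v ∈ Set.range y ∧ dist (f j v) (y j + nearestDist y j • A j v) ≤ 1 / 10 ^ 4 * nearestDist y j)
    (hinj : ∀ j, dist (y j) (y i) ≤ 12 * nearestDist y i → Set.InjOn (f j) ↑(P j))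
    (hex : ∀ j, dist (y j) (y i) ≤ 12 * nearestDist y i → ∀ m, m ≠ j → dist (y m) (y j) ≤ (3 / 2 + 1 / 450) * nearestDist y j →
      ∃ v ∈ P j, f j v = y m)
    (hBlo : ∀ z, 399 / 400 * nearestDist y i * ‖z‖ ≤ ‖B z‖) (hBup : ∀ z, ‖B z‖ ≤ 401 / 400 * nearestDist y i * ‖z‖)
    (hseed : ∃ (M₀ : EuclideanSpace ℝ (Fin 3) →ₗᵢ[ℝ] EuclideanSpace ℝ (Fin 3)) (C₀ : List T3), Estab y A P B i i M₀ C₀ (0, 0, 0) 0 0)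
    {ref : ℤ → T3} {Cz : ℤ → List T3} {e : ℤ → ℤ} {x₀ : T3}
    (hRec1 : ∀ ℓ : ℤ, -5 ≤ ℓ → ℓ ≤ 5 → Cz ℓ ∈ [fccL, fccNegL, hcpL, hcpAltL] ∧ thsum (ref ℓ) = 6 * ℓ ∧ (ref ℓ).2.1 = (ref ℓ).1 ∧
      (3 : ℤ) ∣ ((ref ℓ).2.1 - (ref ℓ).2.2) ∧
      ∀ u : T3, InLayer (tsub (tadd (2 * ℓ, 2 * ℓ, 2 * ℓ) u) (ref ℓ)) → |u.1| ≤ 18 - |ℓ| → |u.2.1| ≤ 18 - |ℓ| → |u.2.2| ≤ 18 - |ℓ| →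
        ∃ k : Fin N, ∃ M : EuclideanSpace ℝ (Fin 3) →ₗᵢ[ℝ] EuclideanSpace ℝ (Fin 3),
          dist (y k) (y i) ≤ 12 * nearestDist y i ∧ 9026 / 10000 * nearestDist y i ≤ nearestDist y k ∧
          nearestDist y k ≤ 10347 / 10000 * nearestDist y i ∧
          Estab y A P B i k M (Cz ℓ) (tadd (2 * ℓ, 2 * ℓ, 2 * ℓ) u) (tauR (nearestDist y i) 31) (dR (nearestDist y i) 31))
    (hRec2 : ∀ ℓ : ℤ, -5 ≤ ℓ → ℓ ≤ 4 → (e ℓ = 1 ∨ e ℓ = -1) ∧ ref (ℓ + 1) = tadd (ref ℓ) (capv 1 (e ℓ) (1, 1, -2)) ∧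
      (∀ δ ∈ dL, capv 1 (e ℓ) δ ∈ Cz ℓ) ∧ (∀ δ ∈ dL, capv (-1) (-(e ℓ)) δ ∈ Cz (ℓ + 1)))
    (hx₀L : InLayer x₀) (hx₀ : tadd (ref 0) x₀ = (0, 0, 0))
    (hRec5 : ∀ (m m' : Fin N) (r : T3), 9967 / 10000 * (9026 / 10000 * nearestDist y i) ≤ nearestDist y m' →
      ‖y m - y i - B (mv r)‖ ≤ dR (nearestDist y i) 31 + 1 / 10 ^ 4 * (10347 / 10000 * nearestDist y i) + tauR (nearestDist y i) 31 →
      ‖y m' - y i - B (mv r)‖ ≤ dR (nearestDist y i) 31 + 1 / 10 ^ 4 * (10347 / 10000 * nearestDist y i) + tauR (nearestDist y i) 31 → m = m')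
    {m : Fin N} (hmi : m ≠ i) (hdm : dist (y m) (y i) ≤ 106 / 25 * nearestDist y i) (hnot : ∀ v ∈ P i, ‖v‖ = 1 → f i v ≠ y m)
    {ℓ : ℤ} (hℓ1 : -5 ≤ ℓ) (hℓ2 : ℓ ≤ 5) {x : T3} (hx : InLayer x)
    (hm : ‖y m - y i - B (mv (tadd (ref ℓ) x))‖ ≤
      dR (nearestDist y i) 31 + 1 / 10 ^ 4 * (10347 / 10000 * nearestDist y i) + tauR (nearestDist y i) 31)
    {σ : ℤ} (hσ : (tadd (ref ℓ) x₀).1 = 2 * ℓ + σ) {a b : ℤ} (ha : (tsub x x₀).1 = 3 * a) (hb : (tsub x x₀).2.1 = 3 * b) :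
    eOf ℓ σ a b ∈ tblOf ℓ.natAbs σ.natAbs ∧ (eOf ℓ σ a b).1 = sgOf σ * a ∧ (eOf ℓ σ a b).2.1 = sgOf σ * b ∧
      (dist (y i) (y m))⁻¹ ^ 6 ≤ (nearestDist y i)⁻¹ ^ 6 * ((tOfE (eOf ℓ σ a b) : ℝ) / 10 ^ 6) := by
  -- the column form of layer `ℓ`, and `σ' = σ`
  obtain ⟨σ', hσ'1, hσ'2, hcol⟩ := col_form hRec2 hx₀ hℓ1 hℓ2
  have hσσ : σ' = σ := by
    have h := congrArg Prod.fst hcol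
    dsimp only at h
    linarith [h, hσ]
  subst hσσ
  -- the in-layer difference `x − x₀ = (3a, 3b, −3a − 3b)` and the label `ref ℓ + x = 2ℓ(1,1,1) + u`
  have hw : InLayer (tsub x x₀) := inLayer_tsub hx hx₀L
  have hc : (tsub x x₀).2.2 = -3 * a - 3 * b := by linarith [hw.1]
  have hr : tadd (ref ℓ) x = tadd (2 * ℓ, 2 * ℓ, 2 * ℓ) (σ' + 3 * a, σ' + 3 * b, -2 * σ' - 3 * a - 3 * b) := by
    simp only [tadd, tsub, Prod.mk.injEq] at hcol ha hb hc ⊢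
    refine ⟨by linarith [hcol.1], by linarith [hcol.2.1], by linarith [hcol.2.2]⟩
  have hu0 : thsum (σ' + 3 * a, σ' + 3 * b, -2 * σ' - 3 * a - 3 * b) = 0 := by simp only [thsum]; ring
  have hT : tsq (tadd (ref ℓ) x) = Tof ℓ σ' a b := by rw [hr, tsq_tadd_axis _ hu0, Tof]; ring
  -- range, box, coordinates
  obtain ⟨h387, h0, h18⟩ := label_range hν hP hA hf hex hBlo hBup hRec5 hmi hdm hnot hm
  rw [hT] at h387 h0 h18
  have hq : ((ℓ.natAbs : ℕ) : ℤ) = |ℓ| := Int.natCast_natAbs ℓ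
  have hℓ5 : |ℓ| ≤ 5 := abs_le.2 ⟨hℓ1, hℓ2⟩
  have hcs := coord_sq_le hu0
  dsimp only at hcs
  have htsq : tsq (σ' + 3 * a, σ' + 3 * b, -2 * σ' - 3 * a - 3 * b) ≤ 387 - 12 * ℓ ^ 2 := by unfold Tof at h387; linarith
  have hb1 : |σ' + 3 * a| ≤ 18 - |ℓ| := coord_box (by linarith [hcs.1]) hℓ5
  have hb2 : |σ' + 3 * b| ≤ 18 - |ℓ| := coord_box (by linarith [hcs.2.1]) hℓ5
  have hb3 : |-2 * σ' - 3 * a - 3 * b| ≤ 18 - |ℓ| := coord_box (by linarith [hcs.2.2]) hℓ5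
  have hbox : |(tsub (tadd (ref ℓ) x) (2 * ℓ, 2 * ℓ, 2 * ℓ)).1| ≤ 18 - |ℓ| ∧ |(tsub (tadd (ref ℓ) x) (2 * ℓ, 2 * ℓ, 2 * ℓ)).2.1| ≤ 18 - |ℓ| ∧
      |(tsub (tadd (ref ℓ) x) (2 * ℓ, 2 * ℓ, 2 * ℓ)).2.2| ≤ 18 - |ℓ| := by
    rw [hr, tsub_tadd_self]
    exact ⟨hb1, hb2, hb3⟩
  have ha8 : |a| ≤ 8 := by
    rw [abs_le] at hb1 hσ'1 ⊢
    constructor <;> omega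
  have hb8 : |b| ≤ 8 := by
    rw [abs_le] at hb2 hσ'1 ⊢
    constructor <;> omega
  -- the class table and the entry
  obtain ⟨hcls, -, -⟩ := layer_sound hℓ1 hℓ2 hσ'1 hσ'2
  obtain ⟨hmem, hok⟩ := classOk_sound hcls ha8 hb8 h387 h0 h18
  obtain ⟨hk1, hk2, hqp, hdepth, hp31, hL, hcert, ht⟩ := entryOk_sound hok
  refine ⟨hmem, hk1, hk2, ?_⟩
  -- depth bookkeeping: `n = p − |ℓ|`, `lnorm (x − x₀) = 6n`
  have hn : ℓ.natAbs + ((eOf ℓ σ' a b).2.2.1 - ℓ.natAbs) + 1 ≤ 31 := by omega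
  have hln : lnorm (tsub x x₀) ≤ 6 * ((((eOf ℓ σ' a b).2.2.1 - ℓ.natAbs : ℕ)) : ℤ) := by
    rw [lnorm_hex ha hb hc]
    rw [sg_mul_add, natAbs_sg_mul, natAbs_sg_mul, natAbs_sg_mul] at hdepth
    have h' : (((2 * ((eOf ℓ σ' a b).2.2.1 - ℓ.natAbs)) : ℕ) : ℤ) = ((a.natAbs + b.natAbs + (a + b).natAbs : ℕ) : ℤ) := by
      exact_mod_cast hdepth
    push_cast [Int.natCast_natAbs] at h'
    linarith
  -- the sharp reading at depth `p`
  obtain ⟨hsharp, -, -⟩ := sharp_site hy hν hP hA hf hinj hex hBlo hBup hseed hRec1 hRec2 hx₀L hx₀ hRec5 hℓ1 hℓ2 hq hn hx hln hbox hm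
  rw [Nat.add_sub_cancel' hqp] at hsharp
  -- the distance and its inverse sixth power
  have htri : ‖B (mv (tadd (ref ℓ) x))‖ ≤ ‖y m - y i‖ + ‖y m - y i - B (mv (tadd (ref ℓ) x))‖ := by
    have h := norm_sub_le (y m - y i) ((y m - y i) - B (mv (tadd (ref ℓ) x)))
    rwa [sub_sub_cancel] at h
  rw [← hT] at hcert
  have hlow := dist_lower hν (norm_mv_sq (tadd (ref ℓ) x)) (norm_nonneg _) (hBlo _) hsharp hcert
  have hdn : ‖y m - y i‖ = dist (y i) (y m) := by rw [← dist_eq_norm, dist_comm]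
  rw [dist_comm] at hdm
  exact inv_pow_six_le hν hL (by linarith [hlow, htri, hdn]) hdm ht

end Summit.AtomisticToContinuum.Crystallization.Theorems.OverbindingBudgetAffineCompressedCutInnerS
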